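import Summits.AnomalousDissipation.AnomalousDissipation.Theorems.DenseLoudDesignerForces.Negative.WitnessAnatomy

/-!
# Negative knowledge for the crux `DenseLoudDesignerForces` (stmt-AnomalousDissipation-1143), VII: band-limited
# witnesses are uniformly quiet (refuted strengthening)

Certified copy of §9 of the cdisprove work file: Bernstein's inequality for band-limited fields,
`meanDissipation ≤ 4π²ΛνE` for band-limited periodic orbits, `bandLoudSet_eq_empty` (the loud set with
witnesses spectrally supported in `|k|² ≤ Λ` is empty once `4π²ΛE ≤ ε(j+1)`) and `not_window_bandLimited`.
Supports stmt-AnomalousDissipation-1143.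
-/

noncomputable section

namespace Summit.AnomalousDissipation.AnomalousDissipation.Theorems.DenseLoudDesignerForces.Negative

open scoped BigOperators Topology ENNReal InnerProductSpace
open Filter Set MeasureTheory UnitAddTorus
open Literature.Analysis.FunctionSpaces Literature.Analysis.FluidPDE
open Summit.AnomalousDissipation.AnomalousDissipation.Theses.BaireTransfer

/-! ## §9 Refuted strengthening: band-limited (finite-dimensional) witnesses are uniformly quiet (Bernstein)

If a witness is spectrally supported in the band `|k|² ≤ Λ` at all times (exact Galerkin-type / generalised
Beltrami / finite-mode periodic solutions), Bernstein's inequality `‖∇u‖₂² ≤ 4π²Λ‖u‖₂²` and the energy budget give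
`ε ≤ 4π²ΛνE`: the band-limited loud sets are EMPTY at every level `j + 1 ≥ 4π²ΛE/ε`, for every `c` (no window
needed).  Loud witness families must let their spectral support escape every finite band as `j → ∞` — the
enstrophy floor of §8 in spectral form. -/

section Bernstein

/-- BERNSTEIN for band-limited smooth fields: `v̂(k) = 0` for `|k|² > Λ` (`Λ ≥ 0`) implies
`‖∇v‖₂² ≤ 4π²Λ ∫‖v‖²` (spectral gradient norm). -/
theorem eGradNormSq_le_of_bandLimited {v : (UnitAddTorus (Fin 3)) → (EuclideanSpace ℝ (Fin 3))} (hv : Torus.IsSmooth v) {Λ : ℝ} (hΛ : 0 ≤ Λ)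
    (hband : ∀ k : Fin 3 → ℤ, Λ < Torus.freqNormSq k → mFourierCoeff (EuclideanSpace.complexify ∘ v) k = 0) :
    Torus.eGradNormSq v ≤ ENNReal.ofReal (4 * Real.pi ^ 2 * Λ * ∫ x, ‖v x‖ ^ 2) := by
  set g : (UnitAddTorus (Fin 3)) → (EuclideanSpace ℂ (Fin 3)) := EuclideanSpace.complexify ∘ v with hg
  have hpar := Torus.hasSum_sq_norm_mFourierCoeff_complexify (hv.memLp 2)
  have hI : 0 ≤ ∫ x, ‖v x‖ ^ 2 := integral_nonneg fun _ => sq_nonneg _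
  -- termwise bound `(weight k)·‖ĝ k‖ₑ² ≤ Λ·‖ĝ k‖ₑ²`
  have hterm : ∀ k : Fin 3 → ℤ,
      (if k = 0 then 0 else ENNReal.ofReal (Torus.freqNormSq k ^ (1 : ℝ))) * ‖mFourierCoeff g k‖ₑ ^ 2 ≤
        ENNReal.ofReal Λ * ‖mFourierCoeff g k‖ₑ ^ 2 := by
    intro k
    split_ifs with hk
    · simp
    · by_cases hb : Λ < Torus.freqNormSq k
      · rw [hband k hb]; simp
      · rw [Real.rpow_one]
        gcongr
        exact not_lt.1 hb
  have hsum : Torus.eHomSobolevSeminorm 1 g ^ 2 ≤ ENNReal.ofReal Λ * ∑' k, ‖mFourierCoeff g k‖ₑ ^ 2 := by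
    rw [Torus.eHomSobolevSeminorm, ENNReal.rpow_half_sq, ← ENNReal.tsum_mul_left]
    exact ENNReal.tsum_le_tsum hterm
  have htsum : ∑' k, ‖mFourierCoeff g k‖ₑ ^ 2 = ENNReal.ofReal (∫ x, ‖v x‖ ^ 2) := by
    have h1 : ∀ k, ‖mFourierCoeff g k‖ₑ ^ 2 = ENNReal.ofReal (‖mFourierCoeff g k‖ ^ 2) := fun k => by
      rw [← ofReal_norm, ENNReal.ofReal_pow (norm_nonneg _)]
    simp_rw [h1]
    rw [← ENNReal.ofReal_tsum_of_nonneg (fun k => sq_nonneg _) hpar.summable, hpar.tsum_eq]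
  rw [Torus.eGradNormSq]
  calc ENNReal.ofReal (4 * Real.pi ^ 2) * Torus.eHomSobolevSeminorm 1 (EuclideanSpace.complexify ∘ v) ^ 2
      ≤ ENNReal.ofReal (4 * Real.pi ^ 2) * (ENNReal.ofReal Λ * ∑' k, ‖mFourierCoeff g k‖ₑ ^ 2) := by
        gcongr
    _ = ENNReal.ofReal (4 * Real.pi ^ 2 * Λ * ∫ x, ‖v x‖ ^ 2) := by
        rw [htsum, ← ENNReal.ofReal_mul (by positivity), ← ENNReal.ofReal_mul (by positivity)]
        congr 1
        ring

variable {ν τ Λ : ℝ} {u : ℝ → (UnitAddTorus (Fin 3)) → (EuclideanSpace ℝ (Fin 3))}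

/-- A band-limited `τ`-periodic smooth field has `meanDissipation ≤ 4π²Λν · meanEnergy` (whatever it solves). -/
theorem meanDissipation_le_of_bandLimited (hu : Torus.IsSmoothSpaceTimeOn univ u) (hper : Function.Periodic u τ)
    (hτ : 0 < τ) (hν : 0 ≤ ν) (hΛ : 0 ≤ Λ)
    (hband : ∀ t (k : Fin 3 → ℤ), Λ < Torus.freqNormSq k → mFourierCoeff (EuclideanSpace.complexify ∘ u t) k = 0) :
    meanDissipation ν u ≤ 4 * Real.pi ^ 2 * Λ * ν * meanEnergy u := by
  rw [meanDissipation_eq_of_periodic hper hτ, meanEnergy_eq_period_mean hper hτ]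
  have he_st : Torus.IsSmoothSpaceTimeOn univ (fun t x => ‖u t x‖ ^ 2) := by
    change ContDiffOn ℝ _ (fun z => ‖Torus.stLift u z‖ ^ 2) _
    exact hu.norm_sq ℝ
  have he_cont : Continuous fun t => ∫ x, ‖u t x‖ ^ 2 :=
    continuousOn_univ.1 (he_st.continuousOn_integral convex_univ)
  have hg_cont : Continuous fun t => ν * (Torus.eGradNormSq (u t)).toReal := by
    have hg : Continuous fun t => Torus.gradNormSq (u t) :=
      continuousOn_univ.1 (hu.continuousOn_gradNormSq convex_univ uniqueDiffOn_univ)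
    refine (hg.const_mul ν).congr fun t => ?_
    rw [Torus.gradNormSq_eq_toReal_eGradNormSq_holds (hu.isSmooth_slice (mem_univ t))]
  have hpt : ∀ t, ν * (Torus.eGradNormSq (u t)).toReal ≤ ν * (4 * Real.pi ^ 2 * Λ * ∫ x, ‖u t x‖ ^ 2) := by
    intro t
    refine mul_le_mul_of_nonneg_left ?_ hν
    have hI : 0 ≤ 4 * Real.pi ^ 2 * Λ * ∫ x, ‖u t x‖ ^ 2 := by
      have : 0 ≤ ∫ x, ‖u t x‖ ^ 2 := integral_nonneg (fun x => sq_nonneg ‖u t x‖)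
      positivity
    have h := eGradNormSq_le_of_bandLimited (hu.isSmooth_slice (mem_univ t)) hΛ (hband t)
    have := ENNReal.toReal_mono ENNReal.ofReal_ne_top h
    rwa [ENNReal.toReal_ofReal hI] at this
  have hmono : ∫ t in (0 : ℝ)..τ, ν * (Torus.eGradNormSq (u t)).toReal ≤
      ∫ t in (0 : ℝ)..τ, ν * (4 * Real.pi ^ 2 * Λ * ∫ x, ‖u t x‖ ^ 2) :=
    intervalIntegral.integral_mono_on hτ.le (hg_cont.intervalIntegrable _ _)
      ((he_cont.const_mul _ |>.const_mul ν).intervalIntegrable _ _) fun t _ => hpt t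
  have heq : ∫ t in (0 : ℝ)..τ, ν * (4 * Real.pi ^ 2 * Λ * ∫ x, ‖u t x‖ ^ 2) =
      ν * (4 * Real.pi ^ 2 * Λ * ∫ t in (0 : ℝ)..τ, ∫ x, ‖u t x‖ ^ 2) := by
    rw [intervalIntegral.integral_const_mul, intervalIntegral.integral_const_mul]
  rw [heq] at hmono
  have hτinv : 0 ≤ τ⁻¹ := inv_nonneg.2 hτ.le
  calc τ⁻¹ * ∫ t in (0 : ℝ)..τ, ν * (Torus.eGradNormSq (u t)).toReal
      ≤ τ⁻¹ * (ν * (4 * Real.pi ^ 2 * Λ * ∫ t in (0 : ℝ)..τ, ∫ x, ‖u t x‖ ^ 2)) :=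
        mul_le_mul_of_nonneg_left hmono hτinv
    _ = 4 * Real.pi ^ 2 * Λ * ν * (τ⁻¹ * ∫ t in (0 : ℝ)..τ, ∫ x, ‖u t x‖ ^ 2) := by ring

/-- The BAND-LIMITED LOUD SET: `LOUD_j(S,E,ε)` with witnesses spectrally supported in `|k|² ≤ Λ` at all times. -/
def bandLoudSet (S : Finset (Fin 3 → ℤ)) (Λ E ε : ℝ) (j : ℕ) : Set (↥S → (EuclideanSpace ℂ (Fin 3))) :=
  {c : ↥S → (EuclideanSpace ℂ (Fin 3)) | ∃ ν : ℝ, 0 < ν ∧ ν < 1 / ((j : ℝ) + 1) ∧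
    ∃ (τ : ℝ) (u : ℝ → (UnitAddTorus (Fin 3)) → (EuclideanSpace ℝ (Fin 3))) (p : ℝ → (UnitAddTorus (Fin 3)) → ℝ), 0 < τ ∧
      Torus.IsClassicalNSSolutionOn Set.univ ν (fun _ => force S c) u p ∧
      Function.Periodic u τ ∧ meanEnergy u ≤ E ∧ ε ≤ meanDissipation ν u ∧
      ∀ t (k : Fin 3 → ℤ), Λ < Torus.freqNormSq k → mFourierCoeff (EuclideanSpace.complexify ∘ u t) k = 0}

/-- Band-limited loud points are loud points. -/
theorem bandLoudSet_subset_loudSet (S : Finset (Fin 3 → ℤ)) (Λ E ε : ℝ) (j : ℕ) :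
    bandLoudSet S Λ E ε j ⊆ loudSet S E ε j := by
  rintro c ⟨ν, hν, hνj, τ, u, p, hτ, hsol, hper, hEu, hεu, -⟩
  exact ⟨ν, hν, hνj, τ, u, p, hτ, hsol, hper, hEu, hεu⟩

/-- BAND-LIMITED WITNESSES ARE UNIFORMLY QUIET: `bandLOUD_j(S,Λ,E,ε) = ∅` as soon as `4π²ΛE ≤ ε(j+1)`
(`ε > 0`, `Λ ≥ 0`), for EVERY stock and every coefficient vector. -/
theorem bandLoudSet_eq_empty (S : Finset (Fin 3 → ℤ)) {Λ E ε : ℝ} (hε : 0 < ε) (hΛ : 0 ≤ Λ) {j : ℕ}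
    (hj : 4 * Real.pi ^ 2 * Λ * E ≤ ε * ((j : ℝ) + 1)) : bandLoudSet S Λ E ε j = ∅ := by
  ext c
  simp only [mem_empty_iff_false, iff_false]
  rintro ⟨ν, hν, hνj, τ, u, p, hτ, hsol, hper, hEu, hεu, hband⟩
  have hmE := meanEnergy_nonneg' hper hτ
  have hE : 0 ≤ E := hmE.trans hEu
  have h1 := meanDissipation_le_of_bandLimited hsol.smooth_velocity hper hτ hν.le hΛ hband
  have hjpos : (0 : ℝ) < (j : ℝ) + 1 := by positivity
  have h2 : ν * ((j : ℝ) + 1) < 1 := by rwa [lt_div_iff₀ hjpos] at hνj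
  -- `ε ≤ 4π²Λ ν E < 4π²ΛE/(j+1) ≤ ε`
  have h3 : ε ≤ 4 * Real.pi ^ 2 * Λ * ν * E :=
    hεu.trans (h1.trans (mul_le_mul_of_nonneg_left hEu (by positivity)))
  have h4 : 4 * Real.pi ^ 2 * Λ * ν * E * ((j : ℝ) + 1) ≤ 4 * Real.pi ^ 2 * Λ * E * 1 := by
    have : 0 ≤ 4 * Real.pi ^ 2 * Λ * E := by positivity
    nlinarith
  nlinarith

/-- REFUTED STRENGTHENING (BandLimited): the crux with band-limited witnesses (any fixed band `Λ`) is FALSE —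
no open non-empty `U` lies in the closure of `bandLOUD_j` for all `j`. -/
theorem not_window_bandLimited (S : Finset (Fin 3 → ℤ)) {Λ E ε : ℝ} (hε : 0 < ε) (hΛ : 0 ≤ Λ)
    {U : Set (↥S → (EuclideanSpace ℂ (Fin 3)))} (hne : U.Nonempty) (hW : ∀ j : ℕ, U ⊆ closure (bandLoudSet S Λ E ε j)) : False := by
  obtain ⟨c, hc⟩ := hne
  obtain ⟨j, hj⟩ := exists_nat_ge (4 * Real.pi ^ 2 * Λ * E / ε)
  have hj' : 4 * Real.pi ^ 2 * Λ * E ≤ ε * ((j : ℝ) + 1) := by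
    rw [div_le_iff₀ hε] at hj; nlinarith
  have := hW j hc
  rw [bandLoudSet_eq_empty S hε hΛ hj', closure_empty] at this
  exact this

end Bernstein

end Summit.AnomalousDissipation.AnomalousDissipation.Theorems.DenseLoudDesignerForces.Negative

end
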